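import Summits.HodgeConjecture.HodgeConjecture.Theses.PadicSemiregularLift
import Summits.HodgeConjecture.HodgeConjecture.Theses.RankFourFaces
import Summits.HodgeConjecture.HodgeConjecture.Theorems.PadicSemiregularLiftHodgeAbelianVarietiesCMPivotConverseHolds
import Summits.HodgeConjecture.HodgeConjecture.Theorems.PadicSemiregularLiftHodgeAbelianVarietiesCMPivotAllFibres

/-!
# Skeleton line `cm-pivot` for crux `HodgeAbelianVarieties` (stmt-HodgeConjecture-1333) — gen 5 (lead prover-line-stmt-HodgeConjecture-1333-c8-0, 2026-08-17): ALIGNMENT with the two existing items — the registered stubs are now stmt-3052 and stmt-16267 VERBATIM; the gen-3/4 refinement of stmt-16267 is kept as a proved offer to that item's own crux chain (born 2026-08-17T04:54Z, `Cruxes/CMToAbelian/Lines/birth.lean`)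

Route `PadicSemiregularLift`, crux r4 `HodgeAbelianVarieties := ∀ A : AbelianVariety ℂ, HodgeConjectureFor A.dim A.X`
(= the Hodge conjecture for every complex abelian variety; OPEN in print from dimension 6: Weil classes on abelian
varieties of Weil type with non-split discriminant (sixfolds) and everything from eightfolds on).

History. Gen 1 (crux strategist): `HodgeAbelianVarieties ⇐ HodgeCM[] ∧ CMAnchoredFamilies[] ∧ LocalVHCAtCM[]`, glue
landed (`Theorems/…CMPivotSplit.lean`, p137346). Gen 2–3 (lead c6): child 1 = the existing item stmt-3052 via the
CM-typing bridge (p138290); child 2 reduced to section data and localised with child 3 to the deep middle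
(`Theorems/…CMPivotStubCmAnchoredFamilies.lean` p137954, `…CMPivotStubLocalVHCAtCM.lean` p137868, `…CMPivotAllFibres.lean`);
`crux ⇐ stmt-3052 ∧ stmt-16267` (`Theorems/…CMPivotBridgeItems.lean`, p139146). Gen 4 (lead c7): the CONVERSE CM-typing
bridge (p141407, p141224, p140966, p141892): `HodgeCM[] ⟺ stmt-3052` and
`HodgeAbelianVarieties ⟺ stmt-3052 ∧ stmt-16267` (`hodgeAbelianVarieties_iff_cmAbelianHodge_and_cmToAbelian`,
`Theorems/…CMPivotConverseHolds.lean`) — the decomposition is a kernel-checked EQUIVALENCE.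

GEN 5 (lead c8, this file). Since gen 4 closed, the transport item stmt-16267 `RankFourFaces.CMToAbelian` received its
own crux chain (`Cruxes/CMToAbelian/Lines/birth.lean`, 2026-08-17T04:54Z: stubs `stub_mumfordTateCMAnchors` — Deligne
1982 Prop. 6.1 / Charles–Schnell Thm. 11.5.11, print — and `stub_abelianSchemeVHC` — variational Hodge for abelian
schemes, open). Gen 4's private stubs 2–3 (`stub_nonCMDeepMiddleSections`, `stub_localVHCAtCMDeepMiddleAll`) are a
REFINEMENT of exactly that item (sections instead of a global class; deep middle `4 ≤ m`, `2 ≤ p ≤ m − 2`; a germ at the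
CM fibre instead of global transport), so keeping them registered HERE would have two chains formalising Deligne's
Prop. 6.1 and the abelian VHC under different names. Gen 5 therefore registers the two EXISTING ITEMS verbatim as the
only stubs of this crux —

* `stub_cmAbelianHodge : CMAbelianHodge[]` — VERBATIM stmt-HodgeConjecture-3052 (HC for CM abelian varieties; routes
  SupersingularIsotypicLift r9 / RankFourFaces target). OPEN — the ARITHMETIC half (first open: CM Weil sixfolds of
  non-split discriminant; Weil classes relative to quartic CM fields; `Lines/cm-pivot-hodgeCM-census-c6.md`).
* `stub_cmToAbelian : CMToAbelian[]` — VERBATIM stmt-HodgeConjecture-16267 (`CMAbelianHodge →` HC for every complex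
  abelian variety; route RankFourFaces r4; crux chain born 2026-08-17). OPEN — the TRANSPORT half (= Grothendieck's
  variational Hodge conjecture for abelian schemes modulo Deligne 1982 Prop. 6.1; the graveyard of this crux's five
  dead transport lines: Glue IV at p-adic anchors, Markman G-rigidity + level-4 Euler obstruction, `{0,1}` no-go,
  isotropy no-go, Schoen non-embedding — `STRATEGY-CENSUS.md §1`).

— composes them BY NAME through the landed glue `hodgeAbelianVarieties_of_cmAbelianHodge_of_cmToAbelian` (p139146),
records the converse (`stubs_iff_hodgeAbelianVarieties`, from c7's p141892: no stub claims more than the crux, and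
jointly they ARE the crux), and keeps the gen-3/4 refinement as the sorry-free theorem
`cmToAbelian_of_nonCMDeepMiddleSections_of_localVHCAtCMDeepMiddleAll : NonCMDeepMiddleSections[] →
LocalVHCAtCMDeepMiddleAll[] → CMToAbelian[]` — this line's OFFER to the CMToAbelian chain (its two antecedents are
that chain's birth stubs sharpened: Deligne's Prop. 6.1 in its literal flat-SECTION form (c) with the CM fibre in
Deligne's §5 typing available through `isCM_iff_exists_cmSubalgebra`, and the VHC only as a GERM at a CM fibre in
the deep middle with Hodge-ness on all fibres as hypothesis; the packaging section ↦ global class is the landed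
`AllFibres.exists_globalClass_of_section`, Deligne 1968 + identity principle).

HONEST STATUS (unchanged since the strategist): decomposition, not a lever. No prover-movable stub remains on this
crux; both stubs are existing open items with their own seats. Sorries: 2 (= the two items).

## Disproof used (`Disproof.lean` v4, 2026-08-16T05:30Z, NO KILL; `## Targets`: nothing on this line): §1 (no stub
has the crux as head — each is an existing item strictly below it: stub 1 restricts the binder, stub 2 is an
implication whose conclusion is the crux), §4/§5 honoured (projective abelian fibres, algebraic families, ℚ-coefficients);
landed `Negative/*`: no instance among the stubs.
-/

set_option linter.dupNamespace false

noncomputable section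

open CategoryTheory
open Literature.AlgebraicGeometry Literature.AlgebraicGeometry.Motives

namespace Summit.HodgeConjecture.HodgeConjecture.Cruxes.HodgeAbelianVarieties.CMPivot

/-! ### Statements (local notations, verbatim from the landed helper files and the two route files) -/

/-- `IsCM[A]` — CM type: an endomorphism with `2 · dim A` distinct eigenvalues on `H¹(A(ℂ); ℂ)`
(verbatim the gallery line's notation). Local notation only. -/
local notation3 (prettyPrint := false) "IsCM[" A "]" =>
  ∃ (ψ : A ⟶ A) (μ : Fin (2 * AbelianVariety.dim A) → ℂ), Function.Injective μ ∧
    ∀ i, Module.End.HasEigenvalue (HodgeTheory.complexBetti.map ψ.hom.hom.hom 1).hom (μ i)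

/-- `QProj[X]` — `X` is quasi-projective over `ℂ`: INLINED body of
`HodgeTheory.IsQuasiProjectiveOver X` (the route file does not import its home module). Local notation only. -/
local notation3 (prettyPrint := false) "QProj[" X "]" =>
  ∃ (P : SchemeOver ℂ) (j : X ⟶ P), IsProjectiveOver P ∧ AlgebraicGeometry.IsOpenImmersion j.left

/-- `FibreIncl[f, B, e, s]` — `e` presents `B` as THE fibre of `f` over `s` (`≫` spelled out). Local notation only. -/
local notation3 (prettyPrint := false) "FibreIncl[" f ", " B ", " e ", " s "]" =>
  ∃ i : AbelianVariety.X B ≅ fiberOver f s, e = CategoryStruct.comp i.hom (fiberι f s)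

/-- `HodgeAlongAll[S, f, G, m, p]` — the global class `G ∈ H^{2p}(𝒳(ℂ); ℂ)` restricts to a RATIONAL class of
Hodge type `(p,p)` (for dimension `m`) on EVERY fibre `𝒳_u` (not only on abelian-presented ones). Local notation only. -/
local notation3 (prettyPrint := false) "HodgeAlongAll[" S ", " f ", " G ", " m ", " p "]" =>
  ∀ u : ComplexPoints S,
    HodgeTheory.IsRationalClass (HodgeTheory.complexBetti.map (fiberι f u) (2 * p) G) ∧
    HodgeTheory.IsOfHodgeType m (fiberOver f u) (2 * p) p p (HodgeTheory.complexBetti.map (fiberι f u) (2 * p) G)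

/-- `LocalVHCAtCMDeepMiddleAll[]` — the DEEP-MIDDLE part of `LocalVHCAtCMAll[]`: three guards `4 ≤ m → 2 ≤ p →
p + 2 ≤ m →` after the binders, everything else byte-identical. Local notation only. -/
local notation3 (prettyPrint := false) "LocalVHCAtCMDeepMiddleAll[]" =>
  ∀ (S 𝒳 : SchemeOver ℂ) (f : 𝒳 ⟶ S) (m p : ℕ) (G : HodgeTheory.complexBetti 𝒳 (2 * p))
    (s₀ : ComplexPoints S) (A₀ : AbelianVariety ℂ) (e₀ : A₀.X ⟶ 𝒳),
    4 ≤ m → 2 ≤ p → p + 2 ≤ m →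
    QProj[𝒳] → QProj[S] → AlgebraicGeometry.Smooth S.hom → IrreducibleSpace S.left →
    IsSmoothProjectiveFamily f m →
    FibreIncl[f, A₀, e₀, s₀] → IsCM[A₀] →
    HodgeTheory.complexBetti.map e₀ (2 * p) G ∈ HodgeTheory.algebraicClasses A₀.X p →
    HodgeAlongAll[S, f, G, m, p] →
    ∃ U : Set (ComplexPoints S), IsOpen U ∧ s₀ ∈ U ∧ ∀ t ∈ U,
      HodgeTheory.complexBetti.map (fiberι f t) (2 * p) G ∈
        HodgeTheory.algebraicClasses (fiberOver f t) p

/-- `NonCMDeepMiddleSections[]` — CM-anchored SECTION data over the Hodge locus for a NON-CM abelian variety of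
dimension `≥ 4` and a rational `(p,p)` class in the deep middle `2 ≤ p`, `2p ≤ dim A` (the landed helper file's
`NonCMSections[]`, `Theorems/PadicSemiregularLiftHodgeAbelianVarietiesCMPivotStubCmAnchoredFamilies.lean`, p137954,
with the three guards `4 ≤ A.dim →`, `2 ≤ p →`, `2 * p ≤ A.dim →` inserted; outside the deep middle HC is a theorem
of the tree, `Unconditional.hodgeAbelianVarieties_iff_four_le_dim_holds`, so no packaging is needed there). In print:
the universal family over the fine moduli scheme `A_{g,d,n}`, the Hodge-locus component through `(A, c)`
(Cattani–Deligne–Kaplan 1995), a CM point on it (Mumford 1969 / Deligne 1982), the tautological flat section.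
Local notation only. [cite: CattaniDeligneKaplan1995JAMS, Thm. 1.1 and Cor. 1.2] [cite: GreenGriffithsKerr2012, Lemma (VI.C.1)] -/
local notation3 (prettyPrint := false) "NonCMDeepMiddleSections[]" =>
  ∀ (A : AbelianVariety ℂ), ¬ IsCM[A] → 4 ≤ A.dim → ∀ (p : ℕ) (c : HodgeTheory.complexBetti A.X (2 * p)),
    2 ≤ p → 2 * p ≤ A.dim →
    HodgeTheory.IsRationalClass c → HodgeTheory.IsOfHodgeType A.dim A.X (2 * p) p p c →
    ∃ (S 𝒳 : SchemeOver ℂ) (f : 𝒳 ⟶ S) (t s₀ : ComplexPoints S) (i : A.X ≅ fiberOver f t)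
      (A₀ : AbelianVariety ℂ) (e₀ : A₀.X ⟶ 𝒳) (σ : ComplexPoints S → HodgeTheory.FiberClass f (2 * p)),
      QProj[𝒳] ∧ QProj[S] ∧ AlgebraicGeometry.Smooth S.hom ∧ IrreducibleSpace S.left ∧
      IsSmoothProjectiveFamily f A.dim ∧
      FibreIncl[f, A₀, e₀, s₀] ∧ IsCM[A₀] ∧
      Continuous σ ∧ (∀ s, (σ s).pt = s) ∧
      (∀ s, σ s ∈ HodgeTheory.locusOfHodgeClasses f A.dim p) ∧
      σ t = ⟨t, HodgeTheory.complexBetti.map i.inv (2 * p) c⟩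

/-- `CMAbelianHodge[]` — VERBATIM the signature of the existing shared item `CMAbelianHodge`
(stmt-HodgeConjecture-3052; `Theses.SupersingularIsotypicLift` / `Theses.RankFourFaces`): the Hodge conjecture
for complex abelian varieties whose `End⁰(A)` contains a commutative reduced `ℚ`-subalgebra of dimension
`2 · dim A`. Local notation only. -/
local notation3 (prettyPrint := false) "CMAbelianHodge[]" =>
  ∀ (A : Literature.AlgebraicGeometry.Motives.AbelianVariety ℂ), Literature.AlgebraicGeometry.Motives.IsSmoothProjective A.dim A.X → (∃ S : Subalgebra ℚ A.endAlgebra, IsReduced ↥S ∧ (∀ x ∈ S, ∀ y ∈ S, x * y = y * x) ∧ Module.finrank ℚ ↥S = 2 * A.dim) → Literature.AlgebraicGeometry.HodgeTheory.HodgeConjectureFor A.dim A.X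

/-- `CMToAbelian[]` — VERBATIM the signature of the existing item `CMToAbelian` (stmt-HodgeConjecture-16267;
`Theses.RankFourFaces`, where the unqualified `CMAbelianHodge` of the item's signature resolves to
`RankFourFaces.CMAbelianHodge`, byte-identical with the SupersingularIsotypicLift copy —
`Theorems.HodgeAbelianVarieties.CMPivot.rankFourFaces_cmAbelianHodge_iff`): HC for CM abelian varieties implies HC
for every complex abelian variety. Local notation only. -/
local notation3 (prettyPrint := false) "CMToAbelian[]" =>
  Summit.HodgeConjecture.HodgeConjecture.Theses.RankFourFaces.CMAbelianHodge → ∀ (A : Literature.AlgebraicGeometry.Motives.AbelianVariety ℂ), Literature.AlgebraicGeometry.Motives.IsSmoothProjective A.dim A.X → Literature.AlgebraicGeometry.HodgeTheory.HodgeConjectureFor A.dim A.X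

/-! ### The two registered stubs (gen 5) — the two existing items, verbatim -/

/-- STUB 1 (OPEN — the ARITHMETIC half; = the EXISTING shared item stmt-HodgeConjecture-3052 verbatim) — **the Hodge
conjecture for CM abelian varieties**: `CMAbelianHodge[]`. Known: nondegenerate CM types (Hodge ring = divisors), prime
dimension (Tankeev), `dim ≤ 5` (Moonen–Zarhin + Markman), CM types dominated by Fermat curves (Shioda) or étale cyclic
Pryms (Schoen; split components only); reduced in print to split Weil classes on CM abelian varieties (André 1992; tree:
`Stubs.hccm_of_cmWeil_of_andre_of_homPullback` p89679 with `homPullback_holds` p119954, so conditional on André's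
decomposition `AndreSplitWeil[]` and the engine `CMWeil[]` only). First open: CM Weil sixfolds of non-split discriminant;
Weil classes relative to quartic CM fields (`dim A = 8`). Why it might fail: a non-algebraic Weil class on a CM abelian
variety (refutes HC). Sources: Pohlmann1968; Andre1992CMHodge; MoonenZarhin1999; Markman2025SurveySecant;
`Lines/cm-pivot-hodgeCM-census-c6.md`. -/
theorem stub_cmAbelianHodge : CMAbelianHodge[] := by
  sorry

/-- STUB 2 (OPEN — the TRANSPORT half; = the EXISTING item stmt-HodgeConjecture-16267 verbatim, crux of route
RankFourFaces with its own chain `Cruxes/CMToAbelian/Lines/birth.lean`) — **HC for CM abelian varieties implies HC for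
every complex abelian variety**: `CMToAbelian[]`. In print it is Deligne 1982 Prop. 6.1 (every `(A, c)` sits in a smooth
connected algebraic family of abelian varieties with a CM fibre along which `c` extends to a flat section of Hodge
classes — a THEOREM: Shimura variety of `MT(A)`, Baily–Borel, Borel, maximal tori) + Grothendieck's variational Hodge
conjecture for abelian schemes (OPEN beyond divisors; Markman 2025 on the Weil locus of fourfolds). This line's
gen-3/4 refinement `NonCMDeepMiddleSections[] ∧ LocalVHCAtCMDeepMiddleAll[] ⟹ CMToAbelian[]` is the theorem
`cmToAbelian_of_nonCMDeepMiddleSections_of_localVHCAtCMDeepMiddleAll` below. Why it might fail: only with HC (the crux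
implies it outright, `Theorems.HodgeAbelianVarieties.CMPivot.cmToAbelian_of_hodgeAbelianVarieties`). Sources:
Deligne1982HodgeCycles Prop. 6.1; CharlesSchnell2014Notes Thm. 11.5.11, Conj. 11.3.1; BlochEsnaultKerz2014CharZero appendix;
arXiv:2509.23403 §12. -/
theorem stub_cmToAbelian : CMToAbelian[] := by
  sorry

/-! ### Name-keyed aliases of the stub statements -/
namespace Registered

/-- Alias of `CMAbelianHodge[]` keyed by the registered stub name. -/
abbrev stub_cmAbelianHodge : Prop := CMAbelianHodge[]
/-- Alias of `CMToAbelian[]` keyed by the registered stub name. -/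
abbrev stub_cmToAbelian : Prop := CMToAbelian[]

end Registered

/-! ### The composition: the stubs imply the crux, by name -/

/-- **The crux from the stub STATEMENTS** (gen 5): the landed item-level glue
`Theorems.HodgeAbelianVarieties.CMPivot.hodgeAbelianVarieties_of_cmAbelianHodge_of_cmToAbelian` (p139146; abelian
varieties are smooth projective, `AbelianVariety.isSmoothProjective_holds`). [folklore] -/
theorem HodgeAbelianVarieties_of_stubs (h₁ : Registered.stub_cmAbelianHodge) (h₂ : Registered.stub_cmToAbelian) :
    Summit.HodgeConjecture.HodgeConjecture.Theses.PadicSemiregularLift.HodgeAbelianVarieties :=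
  Summit.HodgeConjecture.HodgeConjecture.Theorems.HodgeAbelianVarieties.CMPivot.hodgeAbelianVarieties_of_cmAbelianHodge_of_cmToAbelian
    h₁ h₂

/-- **`HodgeAbelianVarieties_of` — the crux BY NAME from the two registered stubs** (hypothesis-free form fed with
the sorried stubs; its own term contains no `sorry`). -/
theorem HodgeAbelianVarieties_of :
    Summit.HodgeConjecture.HodgeConjecture.Theses.PadicSemiregularLift.HodgeAbelianVarieties :=
  HodgeAbelianVarieties_of_stubs stub_cmAbelianHodge stub_cmToAbelian

/-! ### Sanity: the two stubs are jointly EQUIVALENT to the crux (no stub claims more than the summit) -/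

/-- `stub 1 ∧ stub 2 ⟺ crux` — c7's `hodgeAbelianVarieties_iff_cmAbelianHodge_and_cmToAbelian` (p141892) read through
`rankFourFaces_cmAbelianHodge_iff` (the two route copies of `CMAbelianHodge` agree). [folklore] -/
theorem stubs_iff_hodgeAbelianVarieties :
    (Registered.stub_cmAbelianHodge ∧ Registered.stub_cmToAbelian) ↔
      Summit.HodgeConjecture.HodgeConjecture.Theses.PadicSemiregularLift.HodgeAbelianVarieties :=
  Summit.HodgeConjecture.HodgeConjecture.Theorems.HodgeAbelianVarieties.CMPivot.hodgeAbelianVarieties_iff_cmAbelianHodge_and_cmToAbelian.symm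

/-- Stub 1 follows from the crux (restrict the binder). [folklore] -/
theorem stub_cmAbelianHodge_of_hodgeAbelianVarieties
    (h : Summit.HodgeConjecture.HodgeConjecture.Theses.PadicSemiregularLift.HodgeAbelianVarieties) :
    CMAbelianHodge[] :=
  fun A _ _ => h A

/-- Stub 2 follows from the crux (its conclusion is the crux with a spare hypothesis). [folklore] -/
theorem stub_cmToAbelian_of_hodgeAbelianVarieties
    (h : Summit.HodgeConjecture.HodgeConjecture.Theses.PadicSemiregularLift.HodgeAbelianVarieties) :
    CMToAbelian[] :=
  fun _ A _ => h A

/-! ### The gen-3/4 refinement of stub 2, offered to the CMToAbelian chain (sorry-free) -/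

/-- **Children 2 ∧ 3 of gen 4 imply stmt-16267**: CM-anchored SECTION data over the Hodge locus of every non-CM
`(A, c)` in the deep middle (`NonCMDeepMiddleSections[]`, Deligne 1982 Prop. 6.1 (c) in section form, print) and
the local variational Hodge GERM at a CM fibre in the deep middle with Hodge-ness on all fibres
(`LocalVHCAtCMDeepMiddleAll[]`, open) give `CMToAbelian[]`: feed `CMAbelianHodge` through the bridge
`hodgeCM_of_cmAbelianHodge` (p139146) into the landed all-fibres composition
`AllFibres.hodgeAbelianVarieties_of_hodgeCM_of_nonCMDeepMiddleSections_of_localVHCAtCMDeepMiddleAll` (Deligne 1968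
packaging `exists_globalClass_of_section`, corners by Lefschetz `(1,1)` / hard Lefschetz / `dim ≤ 3`, Baire spreading
by `charlesSchnell_algebraicityLocus_iUnion_closed_holds`). [cite: Deligne1982HodgeCycles, Prop. 6.1]
[cite: BlochEsnaultKerz2014CharZero, appendix] [cite: CharlesSchnell2014Notes, Prop. 11.3.5 and Thm. 11.5.11] -/
theorem cmToAbelian_of_nonCMDeepMiddleSections_of_localVHCAtCMDeepMiddleAll : NonCMDeepMiddleSections[] → LocalVHCAtCMDeepMiddleAll[] → CMToAbelian[] :=
  fun h₂ h₃ h₁ A _ =>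
    AllFibres.hodgeAbelianVarieties_of_hodgeCM_of_nonCMDeepMiddleSections_of_localVHCAtCMDeepMiddleAll
      (Summit.HodgeConjecture.HodgeConjecture.Theorems.HodgeAbelianVarieties.CMPivot.hodgeCM_of_cmAbelianHodge h₁)
      h₂ h₃ A

end Summit.HodgeConjecture.HodgeConjecture.Cruxes.HodgeAbelianVarieties.CMPivot

end
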